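import Literature.NumberTheory.GaloisRepresentations.GaloisSubgroups
import Literature.NumberTheory.GaloisRepresentations.GaloisCohomologyProofs
import Literature.NumberTheory.GaloisRepresentations.CoinducedModule
import Literature.NumberTheory.GaloisRepresentations.NaturalIrrationalities
import HarnessLib

/-!
# Hilbert's Theorem 90 for the subgroups `Gal(K̄/F) ≤ Γ_k` (Serre, *Corps locaux* X §1 Prop. 2)

For a subextension `F ⊆ K̄` of `k`, `H¹(Gal(K̄/F), K̄ˣ) = 0`, where
`Gal(K̄/F) = galFixing k F ≤ Γ_k`
carries the subspace topology and `K̄ˣ` is the discrete `Γ_k`-module `DiscreteGaloisModule.units k`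
restricted to it (`subsingleton_one_units_galFixing`).  This is Hilbert 90 for the field `F` and its
normal extension `K̄/F` (the tree's `AlgEquiv.exists_smul_div_eq_of_isOpen`, Serre's Poincaré-series
proof for locally constant cocycles), transported along the continuous isomorphism
`Aut_F(K̄) → Gal(K̄/F)`, `τ ↦ τ|_k` (`galFixingOfAlgEquiv`, `continuous_restrictScalarsHom`).

It is the input "`H¹(Γ(E), K̄ˣ) = 0`" of the inflation–restriction steps in the proof of
Serre II §3.1 Prop. 5 towards
`Literature.NumberTheory.GaloisRepresentations.tsen_fieldCdLE_one_of_trdeg_eq_one`.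

## References

* J.-P. Serre, *Corps locaux* / *Local Fields* (1979), X §1 Prop. 2, X §3. [SerreLocalFields1979]
* J.-P. Serre, *Cohomologie galoisienne* (1997), II §1.2 Prop. 1. [SerreGaloisCohomology1997]
-/

noncomputable section

open Topology Filter IntermediateField Field

universe u

namespace Literature.NumberTheory.GaloisRepresentations

open LocalWeilDatum

variable {k : Type u} [Field k]

section RestrictScalars

variable (F : IntermediateField k (AlgebraicClosure k))

/-- `K̄/F` is normal for every subextension `F` of `K̄/k`. [folklore] -/
theorem normal_algebraicClosure_intermediateField : Normal F (AlgebraicClosure k) :=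
  Normal.tower_top_of_normal k F (AlgebraicClosure k)

/-- `Aut_F(K̄) → Γ_k`, `τ ↦ τ|_k`, as a group homomorphism (Mathlib `AlgEquiv.restrictScalarsHom`
followed by the identification `absoluteGaloisGroup.toAlgEquiv`). [folklore] -/
def toAbsGalHom : (AlgebraicClosure k ≃ₐ[F] AlgebraicClosure k) →* absoluteGaloisGroup k :=
  (absoluteGaloisGroup.toAlgEquiv k).symm.toMonoidHom.comp
    (AlgEquiv.restrictScalarsHom k :
      (AlgebraicClosure k ≃ₐ[F] AlgebraicClosure k) →*
        (AlgebraicClosure k ≃ₐ[k] AlgebraicClosure k))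

/-- `toAbsGalHom F τ` acts on `K̄` as `τ`. [folklore] -/
@[simp] theorem toAbsGalHom_smul (τ : AlgebraicClosure k ≃ₐ[F] AlgebraicClosure k)
    (x : AlgebraicClosure k) : toAbsGalHom F τ • x = τ x := rfl

/-- `toAbsGalHom F` takes values in `Gal(K̄/F)`. [folklore] -/
theorem toAbsGalHom_mem_galFixing (τ : AlgebraicClosure k ≃ₐ[F] AlgebraicClosure k) :
    toAbsGalHom F τ ∈ galFixing k F :=
  (mem_galFixing_iff k).2 fun x hx => by simpa using τ.commutes ⟨x, hx⟩

/-- **`Aut_F(K̄) → Gal(K̄/F) ≤ Γ_k`**, `τ ↦ τ|_k`, as a group homomorphism into the fixing subgroup.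
[cite: SerreGaloisCohomology1997, II §1.1] -/
def galFixingOfAlgEquiv : (AlgebraicClosure k ≃ₐ[F] AlgebraicClosure k) →* galFixing k F :=
  (toAbsGalHom F).codRestrict (galFixing k F) (toAbsGalHom_mem_galFixing F)

/-- The underlying element of `galFixingOfAlgEquiv F τ` acts as `τ`. [folklore] -/
theorem coe_galFixingOfAlgEquiv_smul (τ : AlgebraicClosure k ≃ₐ[F] AlgebraicClosure k)
    (x : AlgebraicClosure k) :
    ((galFixingOfAlgEquiv F τ : galFixing k F) : absoluteGaloisGroup k) • x = τ x :=
  rfl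

/-- `galFixingOfAlgEquiv F` is continuous (Krull topology to the subspace topology; restriction of
scalars is continuous, the tree's `continuous_restrictScalarsHom`). [folklore] -/
theorem continuous_galFixingOfAlgEquiv : Continuous (galFixingOfAlgEquiv F) :=
  (continuous_toAlgEquiv_symm.comp
    (continuous_restrictScalarsHom (k := k) (K := F) (Ω := AlgebraicClosure k)) :
    Continuous (toAbsGalHom F)).subtype_mk _

/-- `galFixingOfAlgEquiv F` is surjective: an automorphism fixing `F` pointwise is `F`-linear.
[folklore] -/
theorem galFixingOfAlgEquiv_surjective : Function.Surjective (galFixingOfAlgEquiv F) := by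
  rintro ⟨σ, hσ⟩
  rw [mem_galFixing_iff] at hσ
  let τ : AlgebraicClosure k ≃ₐ[F] AlgebraicClosure k :=
    AlgEquiv.ofRingEquiv (f := (absoluteGaloisGroup.toAlgEquiv k σ).toRingEquiv) fun r => hσ r r.2
  refine ⟨τ, Subtype.ext ?_⟩
  apply (absoluteGaloisGroup.toAlgEquiv k).injective
  change (absoluteGaloisGroup.toAlgEquiv k) ((absoluteGaloisGroup.toAlgEquiv k).symm
    (AlgEquiv.restrictScalarsHom k τ)) = absoluteGaloisGroup.toAlgEquiv k σ
  rw [MulEquiv.apply_symm_apply]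
  exact AlgEquiv.ext fun _ => rfl

end RestrictScalars

/-! ### `H¹(Gal(K̄/F), K̄ˣ) = 0` -/

section HilbertNinety

open DiscreteGaloisModule

/-- **Hilbert's Theorem 90 for `Gal(K̄/F) ≤ Γ_k`**: `H¹(Gal(K̄/F), K̄ˣ) = 0` for every subextension
`F ⊆ K̄` of `k`, for Mathlib's continuous cohomology of the subgroup `galFixing k F` (subspace
topology)
with values in the restriction of the discrete `Γ_k`-module `K̄ˣ`.  A class is represented by a
continuous inhomogeneous cocycle (`ContinuousCohomology.subsingleton_one_of_inhomogeneous`);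
pulled back to `Aut_F(K̄)` along `galFixingOfAlgEquiv` it is a locally constant cocycle of the
normal
extension `K̄/F`, hence a coboundary by `AlgEquiv.exists_smul_div_eq_of_isOpen` (Serre's proof of
Hilbert 90 by Poincaré series). [cite: SerreLocalFields1979, X §1 Prop. 2]
[cite: SerreGaloisCohomology1997, II §1.2 Prop. 1] -/
theorem subsingleton_one_units_galFixing (F : IntermediateField k (AlgebraicClosure k)) :
    Subsingleton (continuousCohomology 1
      (((units k).restrict (subgroupIncl (galFixing k F))).toTopRep)) := by
  classical
  haveI := normal_algebraicClosure_intermediateField F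
  refine ContinuousCohomology.subsingleton_one_of_inhomogeneous _ fun φ hφ => ?_
  -- the multiplicative cocycle `u : Gal(K̄/F) → K̄ˣ` underlying `φ`
  let u : galFixing k F → (AlgebraicClosure k)ˣ := fun g => (UnitsCarrier.toAdditive (φ g)).toMul
  have hu : ∀ g h : galFixing k F, u (g * h) = u g * (g : absoluteGaloisGroup k) • u h := by
    intro g h
    change (UnitsCarrier.toAdditive (φ (g * h))).toMul =
      (UnitsCarrier.toAdditive (φ g)).toMul *
        (g : absoluteGaloisGroup k) • (UnitsCarrier.toAdditive (φ h)).toMul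
    rw [hφ, map_add, toMul_add]
    rfl
  -- transport to `Aut_F(K̄)` with Mathlib's action `τ • x = Units.map τ x` on `K̄ˣ`
  let j := galFixingOfAlgEquiv F
  let f : (AlgebraicClosure k ≃ₐ[F] AlgebraicClosure k) → (AlgebraicClosure k)ˣ := fun τ => u (j τ)
  have hsmul : ∀ (τ : AlgebraicClosure k ≃ₐ[F] AlgebraicClosure k) (x : (AlgebraicClosure k)ˣ),
      τ • x = ((j τ : galFixing k F) : absoluteGaloisGroup k) • x := fun τ x => Units.ext rfl
  have hf : ∀ g h, f (g * h) = g • f h * f g := by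
    intro g h
    change u (j (g * h)) = _
    rw [map_mul, hu, hsmul, mul_comm]
  have hopen : IsOpen {τ | f τ = 1} := by
    have hc : IsOpen ((fun τ => φ (j τ)) ⁻¹' {0}) :=
      (isOpen_discrete _).preimage (φ.continuous.comp (continuous_galFixingOfAlgEquiv F))
    exact hc
  obtain ⟨x, hx⟩ := AlgEquiv.exists_smul_div_eq_of_isOpen f hf hopen
  refine ⟨UnitsCarrier.ofUnits x, fun g => ?_⟩
  obtain ⟨τ, rfl⟩ := galFixingOfAlgEquiv_surjective F g
  apply UnitsCarrier.toAdditive.injective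
  apply Additive.toMul.injective
  change u (j τ) = (UnitsCarrier.toAdditive
    ((units k) ((j τ : galFixing k F) : absoluteGaloisGroup k) (UnitsCarrier.ofUnits x) -
      UnitsCarrier.ofUnits x)).toMul
  rw [map_sub, toMul_sub]
  change f τ = ((j τ : galFixing k F) : absoluteGaloisGroup k) • x / x
  rw [← hsmul]
  exact (hx τ).symm

end HilbertNinety

end Literature.NumberTheory.GaloisRepresentations

end
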